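import Literature.AnabelianGeometry.EtaleTheta.ClassicalThetaProductDerivative
import HarnessLib

/-!
# [EtTh] Proposition 1.4 (i) "zeroes of order 1 at the cusps": transport at an arbitrary zero, the
size of `Θ̈′` at the cusps, and the characteristic-`2` multiplicity at EVERY cusp

Mochizuki, *The étale theta function and its Frobenioid-theoretic manifestations*, Publ. RIMS **45**
(2009) 227–349, Prop. 1.4 (i) [cite: MochizukiEtTh2009, Prop 1.4 (i) p.21] (PRIMS PDF p. 21 =
printed p. 247). Layer L2 of the abc-iut cell, wave-2 unit W2-L2-02 (seat abc-iut-L2-t6, gen 4);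
PROOF-ONLY sequel of `ClassicalThetaProductDerivative.lean` (gen 3: `Θ̈′(±q̈^a) =
(−1)^a q̈^{−a(a+1)} · 2 ∏ (1 − q̈^{2n})³`, `Θ̈′(q̈^a) ≠ 0 ↔ 2 ≠ 0`, characteristic `2` at `Ü = 1`);
no definitions, no named facts. `L` is complete nontrivially normed ULTRAMETRIC (the paper's
`K̈ ⊇ ℚ_p`; any characteristic) unless said otherwise, `‖q̈‖ < 1`, `Θ̈ = thetaDdot q̈`,
`H = thetaDdotAux q̈` (`Θ̈(Ü) = Ü (Ü² − 1) H(Ü)`).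

* `hasDerivAt_thetaDdot_zpow_mul_of_eq_zero` — the explicit transport of a derivative along
  `Θ̈(q̈^a Ü) = (−1)^a q̈^{−a²} Ü^{−2a} Θ̈(Ü)` (Prop. 1.4 (ii)) at ANY zero `Ü₀ ≠ 0`:
  `Θ̈′(q̈^a Ü₀) = (−1)^a q̈^{−a(a+1)} Ü₀^{−2a} Θ̈′(Ü₀)` (any normed field; the parent's
  `hasDerivAt_thetaDdot_zpow_mul_of_sq_eq_one` is the case `Ü₀² = 1`);
* `hasDerivAt_thetaDdot_zpow`, `hasDerivAt_thetaDdot_neg_zpow` — `HasDerivAt` forms at `±q̈^a`;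
* `norm_tprod_one_sub_qpow_succ` — `‖∏_{n ≥ 1} (1 − q̈^{2n})‖ = 1`; hence
  `norm_deriv_thetaDdot_zpow` / `norm_deriv_thetaDdot_neg_zpow` —
  **`‖Θ̈′(±q̈^a)‖ = ‖2‖ · ‖q̈‖^{−a(a+1)}`**: the zero at a cusp is simple iff `2 ≠ 0` in `L`
  (`deriv_thetaDdot_neg_zpow_ne_zero_iff` completes the parent's `deriv_thetaDdot_zpow_ne_zero_iff`),
  and for `K̈ ⊇ ℚ_2` the derivative is non-zero of norm `‖q̈‖^{−a(a+1)}/2`;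
* characteristic `2` (`(2 : L) = 0`): the first-order quotient `Θ̈(Ü)/(Ü − 1) → 0`
  (`tendsto_thetaDdot_div_sub_one_of_two_eq_zero`) and, at EVERY cusp (where `−q̈^a = q̈^a`),
  **`Θ̈(W)/(W − q̈^a)² → q̈^{−a(a+2)} ∏ (1 − q̈^{2n})³ ≠ 0`**
  (`tendsto_thetaDdot_div_sub_zpow_sq_of_two_eq_zero`, `exists_tendsto_thetaDdot_div_sq_of_two_eq_zero`)
  — multiplicity exactly `2`, the transport the parent file's docstring announces. NOTE: in
  characteristic `2` every iterated derivative of `Θ̈` vanishes at a cusp (`(Ü − 1)²` has second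
  derivative `2 = 0`), so `deriv` cannot express multiplicity; the quotient limits are the honest
  statement.

Everything here is classical (Jacobi 1829) and undisputed. HONEST FRAMING: this file takes no side on
any disputed claim of the IUT corpus; typed ≠ endorsed.
-/

namespace Literature.AnabelianGeometry.EtaleTheta

open Filter
open scoped Topology

/-! ### Transport at an arbitrary zero `Ü₀` (explicit constant `(−1)^a q̈^{−a(a+1)} Ü₀^{−2a}`) -/

section TransportGeneral

variable {L : Type*} [NontriviallyNormedField L] {q2 U₀ d : L}

/-- **Explicit transport along the functional equation at any zero** (Prop. 1.4 (ii)): if `Θ̈(Ü₀) = 0`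
and `Θ̈` has derivative `d` at `Ü₀ ≠ 0`, then at `q̈^a Ü₀` it has derivative
`(−1)^a q̈^{−a(a+1)} Ü₀^{−2a} · d` (differentiate `Θ̈(W) = (−1)^a q̈^{−a²} (q̈^{−a} W)^{−2a} Θ̈(q̈^{−a} W)`
at `W = q̈^a Ü₀`; the term through `Θ̈(Ü₀) = 0` drops). Any normed field; generalises
`hasDerivAt_thetaDdot_zpow_mul_of_sq_eq_one` (`Ü₀² = 1`). [cite: MochizukiEtTh2009, Prop 1.4 (ii) p.22] -/
theorem hasDerivAt_thetaDdot_zpow_mul_of_eq_zero (hq0 : q2 ≠ 0) (hU₀ : U₀ ≠ 0)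
    (h0 : thetaDdot q2 U₀ = 0) (hd : HasDerivAt (thetaDdot q2) d U₀) (a : ℤ) :
    HasDerivAt (thetaDdot q2)
      (((a.negOnePow : ℤ) : L) * q2 ^ (-(a * (a + 1))) * U₀ ^ (-(2 * a)) * d) (q2 ^ a * U₀) := by
  set W₀ : L := q2 ^ a * U₀ with hW₀def
  have hqa : q2 ^ a ≠ 0 := zpow_ne_zero a hq0
  have hqa' : q2 ^ (-a) ≠ 0 := zpow_ne_zero _ hq0
  have hW₀ : W₀ ≠ 0 := mul_ne_zero hqa hU₀
  have hW : q2 ^ (-a) * W₀ = U₀ := by rw [hW₀def, zpow_neg, inv_mul_cancel_left₀ hqa]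
  set κ : L := ((a.negOnePow : ℤ) : L) * q2 ^ (-(a * a)) * (q2 ^ (-a)) ^ (-(2 * a)) with hκ
  have hG : HasDerivAt (fun W : L => κ * W ^ (-(2 * a)))
      (κ * (((-(2 * a) : ℤ) : L) * W₀ ^ (-(2 * a) - 1))) W₀ :=
    (hasDerivAt_zpow (-(2 * a)) W₀ (Or.inl hW₀)).const_mul κ
  have hK : HasDerivAt (fun W : L => thetaDdot q2 (q2 ^ (-a) * W)) (d * (q2 ^ (-a) * 1)) W₀ := by
    have hd' : HasDerivAt (thetaDdot q2) d (q2 ^ (-a) * W₀) := by rwa [hW]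
    exact hd'.comp W₀ ((hasDerivAt_id W₀).const_mul (q2 ^ (-a)))
  have hF := hG.mul hK
  rw [hW, h0, mul_zero, zero_add] at hF
  -- the scalar identity `κ W₀^{−2a} q̈^{−a} = (−1)^a q̈^{−a(a+1)} Ü₀^{−2a}`
  have e1 : (q2 ^ (-a)) ^ (-(2 * a)) = q2 ^ (2 * a * a) := by rw [← zpow_mul]; congr 1; ring
  have e2 : W₀ ^ (-(2 * a)) = q2 ^ (-(2 * a * a)) * U₀ ^ (-(2 * a)) := by
    rw [hW₀def, mul_zpow, ← zpow_mul]; congr 2; ring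
  have e3 : q2 ^ (-(a * (a + 1))) =
      q2 ^ (-(a * a)) * q2 ^ (2 * a * a) * q2 ^ (-(2 * a * a)) * q2 ^ (-a) := by
    rw [← zpow_add₀ hq0, ← zpow_add₀ hq0, ← zpow_add₀ hq0]; congr 1; ring
  refine (hF.congr_of_eventuallyEq ?_).congr_deriv ?_
  · filter_upwards [eventually_ne_nhds hW₀] with W hW'
    have hU : q2 ^ (-a) * W ≠ 0 := mul_ne_zero hqa' hW'
    have h := thetaDdot_zpow_mul hq0 hU a
    rw [← mul_assoc, ← zpow_add₀ hq0, add_neg_cancel, zpow_zero, one_mul] at h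
    rw [Pi.mul_apply, h, mul_zpow, hκ]
    ring
  · rw [e3, hκ, e1, e2]
    ring

end TransportGeneral

/-! ### `HasDerivAt` forms at the cusps and the size of the derivative -/

section CuspNorms

variable {L : Type*} [NontriviallyNormedField L] [CompleteSpace L] [IsUltrametricDist L] {q2 : L}

/-- `Θ̈` is differentiable at `−1` with `Θ̈′(−1) = 2 ∏_{n ≥ 1} (1 − q̈^{2n})³` (`HasDerivAt` form of
`deriv_thetaDdot_neg_one_eq_tprod`). [cite: MochizukiEtTh2009, Prop 1.4 (i) p.21] -/
theorem hasDerivAt_thetaDdot_neg_one_tprod (hq : ‖q2‖ < 1) :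
    HasDerivAt (thetaDdot q2) (2 * (∏' n : ℕ, (1 - q2 ^ (2 * (n + 1)))) ^ 3) (-1) := by
  rw [← thetaDdotAux_one_eq_tprod_pow_three hq]
  exact hasDerivAt_thetaDdot_neg_one hq

/-- **`HasDerivAt` at the cusp `q̈^a`**: `Θ̈′(q̈^a) = (−1)^a q̈^{−a(a+1)} · 2 ∏_{n ≥ 1} (1 − q̈^{2n})³`
(`0 < ‖q̈‖ < 1`). [cite: MochizukiEtTh2009, Prop 1.4 (i) p.21] -/
theorem hasDerivAt_thetaDdot_zpow (hq0 : q2 ≠ 0) (hq : ‖q2‖ < 1) (a : ℤ) :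
    HasDerivAt (thetaDdot q2)
      ((-1) ^ a * q2 ^ (-(a * (a + 1))) * (2 * (∏' n : ℕ, (1 - q2 ^ (2 * (n + 1)))) ^ 3)) (q2 ^ a) := by
  have h := hasDerivAt_thetaDdot_zpow_mul_of_sq_eq_one hq0 (one_pow 2)
    (thetaDdot_one_of_norm_lt_one hq) (hasDerivAt_thetaDdot_one_tprod hq) a
  rw [mul_one, Int.cast_negOnePow] at h
  exact h

/-- **`HasDerivAt` at the cusp `−q̈^a`**: `Θ̈′(−q̈^a) = (−1)^a q̈^{−a(a+1)} · 2 ∏_{n ≥ 1} (1 − q̈^{2n})³`.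
[cite: MochizukiEtTh2009, Prop 1.4 (i) p.21] -/
theorem hasDerivAt_thetaDdot_neg_zpow (hq0 : q2 ≠ 0) (hq : ‖q2‖ < 1) (a : ℤ) :
    HasDerivAt (thetaDdot q2)
      ((-1) ^ a * q2 ^ (-(a * (a + 1))) * (2 * (∏' n : ℕ, (1 - q2 ^ (2 * (n + 1)))) ^ 3))
      (-(q2 ^ a)) := by
  have h := hasDerivAt_thetaDdot_zpow_mul_of_sq_eq_one hq0 (by norm_num : (-1 : L) ^ 2 = 1)
    (by rw [thetaDdot_neg, thetaDdot_one_of_norm_lt_one hq, neg_zero])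
    (hasDerivAt_thetaDdot_neg_one_tprod hq) a
  rw [mul_neg_one, Int.cast_negOnePow] at h
  exact h

/-- In an ultrametric field `‖∏_{n ≥ 1} (1 − q̈^{2n})‖ = 1` (`‖q̈‖ < 1`): its cube is `H(1)`, of norm `1`
(`norm_thetaDdotAux_eq`). [cite: MochizukiEtTh2009, Prop 1.4 (i) p.21] -/
theorem norm_tprod_one_sub_qpow_succ (hq : ‖q2‖ < 1) : ‖∏' n : ℕ, (1 - q2 ^ (2 * (n + 1)))‖ = 1 := by
  have h3 : ‖∏' n : ℕ, (1 - q2 ^ (2 * (n + 1)))‖ ^ 3 = 1 := by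
    rw [← norm_pow, ← thetaDdotAux_one_eq_tprod_pow_three hq,
      norm_thetaDdotAux_eq hq (by rwa [norm_one]) (by rw [norm_one]), norm_one]
    norm_num
  exact (pow_eq_one_iff_of_nonneg (norm_nonneg _) (by norm_num)).mp h3

/-- **Size of the derivative at the cusps**: `‖Θ̈′(q̈^a)‖ = ‖2‖ · ‖q̈‖^{−a(a+1)}` (`0 < ‖q̈‖ < 1`). In
particular the zero at `q̈^a` is simple iff `2 ≠ 0` in `L` (`deriv_thetaDdot_zpow_ne_zero_iff`), and for
`K̈ ⊇ ℚ_2` the derivative is non-zero of norm `‖q̈‖^{−a(a+1)}/2`. [cite: MochizukiEtTh2009, Prop 1.4 (i) p.21] -/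
theorem norm_deriv_thetaDdot_zpow (hq0 : q2 ≠ 0) (hq : ‖q2‖ < 1) (a : ℤ) :
    ‖deriv (thetaDdot q2) (q2 ^ a)‖ = ‖(2 : L)‖ * ‖q2‖ ^ (-(a * (a + 1))) := by
  rw [deriv_thetaDdot_zpow_eq hq0 hq a, norm_mul, norm_mul, norm_mul, norm_pow,
    norm_tprod_one_sub_qpow_succ hq, norm_zpow, norm_neg, norm_one, one_zpow, norm_zpow]
  ring

/-- `‖Θ̈′(−q̈^a)‖ = ‖2‖ · ‖q̈‖^{−a(a+1)}` likewise. [cite: MochizukiEtTh2009, Prop 1.4 (i) p.21] -/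
theorem norm_deriv_thetaDdot_neg_zpow (hq0 : q2 ≠ 0) (hq : ‖q2‖ < 1) (a : ℤ) :
    ‖deriv (thetaDdot q2) (-(q2 ^ a))‖ = ‖(2 : L)‖ * ‖q2‖ ^ (-(a * (a + 1))) := by
  rw [deriv_thetaDdot_neg_zpow_eq hq0 hq a, ← deriv_thetaDdot_zpow_eq hq0 hq a,
    norm_deriv_thetaDdot_zpow hq0 hq a]

/-- The symmetric case of `deriv_thetaDdot_zpow_ne_zero_iff`: `Θ̈′(−q̈^a) ≠ 0 ↔ (2 : L) ≠ 0`.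
[cite: MochizukiEtTh2009, Prop 1.4 (i) p.21] -/
theorem deriv_thetaDdot_neg_zpow_ne_zero_iff (hq0 : q2 ≠ 0) (hq : ‖q2‖ < 1) (a : ℤ) :
    deriv (thetaDdot q2) (-(q2 ^ a)) ≠ 0 ↔ (2 : L) ≠ 0 := by
  rw [deriv_thetaDdot_neg_zpow_eq hq0 hq a, ← deriv_thetaDdot_zpow_eq hq0 hq a,
    deriv_thetaDdot_zpow_ne_zero_iff hq0 hq a]

end CuspNorms

/-! ### Characteristic `2`: multiplicity exactly `2` at every cusp -/

section CharTwoCusps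

variable {L : Type*} [NontriviallyNormedField L] [CompleteSpace L] [IsUltrametricDist L] {q2 : L}

omit [CompleteSpace L] [IsUltrametricDist L] in
/-- In characteristic `2` the cusps `q̈^a` and `−q̈^a` coincide. [folklore] -/
private theorem neg_zpow_eq_zpow_of_two_eq_zero (h2 : (2 : L) = 0) (a : ℤ) : -(q2 ^ a) = q2 ^ a := by
  have h : (q2 ^ a) + (q2 ^ a) = 0 := by rw [← two_mul, h2, zero_mul]
  exact neg_eq_of_add_eq_zero_left h

/-- In characteristic `2` the FIRST-order quotient tends to `0`: `Θ̈(Ü)/(Ü − 1) → 0` as `Ü → 1`,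
`Ü ≠ 1` (`Θ̈′(1) = 2 H(1) = 0`); with `tendsto_thetaDdot_div_sub_one_sq_of_two_eq_zero` the zero at `1`
has multiplicity exactly `2`. [cite: MochizukiEtTh2009, Prop 1.4 (i) p.21] -/
theorem tendsto_thetaDdot_div_sub_one_of_two_eq_zero (hq : ‖q2‖ < 1) (h2 : (2 : L) = 0) :
    Tendsto (fun U : L => thetaDdot q2 U / (U - 1)) (𝓝[≠] 1) (𝓝 0) := by
  have h := (hasDerivAt_thetaDdot_one hq).tendsto_slope
  rw [h2, zero_mul] at h
  refine h.congr' ?_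
  filter_upwards [self_mem_nhdsWithin] with U hU1
  rw [slope_def_field, thetaDdot_one_of_norm_lt_one hq, sub_zero]

omit [CompleteSpace L] [IsUltrametricDist L] in
/-- `W ↦ q̈^{−a} W` maps the punctured neighbourhoods of `q̈^a` into those of `1`. [folklore] -/
private theorem tendsto_zpow_neg_mul_nhdsWithin (hq0 : q2 ≠ 0) (a : ℤ) :
    Tendsto (fun W : L => q2 ^ (-a) * W) (𝓝[≠] (q2 ^ a)) (𝓝[≠] 1) := by
  have hqa : q2 ^ a ≠ 0 := zpow_ne_zero a hq0
  have h1 : q2 ^ (-a) * q2 ^ a = 1 := by rw [zpow_neg, inv_mul_cancel₀ hqa]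
  refine tendsto_nhdsWithin_of_tendsto_nhds_of_eventually_within _ ?_ ?_
  · have hc : Tendsto (fun W : L => q2 ^ (-a) * W) (𝓝 (q2 ^ a)) (𝓝 (q2 ^ (-a) * q2 ^ a)) :=
      ((continuous_const.mul continuous_id).tendsto (q2 ^ a))
    rw [h1] at hc
    exact hc.mono_left nhdsWithin_le_nhds
  · filter_upwards [self_mem_nhdsWithin] with W hW
    intro hW1
    apply hW
    have : q2 ^ a * (q2 ^ (-a) * W) = q2 ^ a * 1 := by rw [hW1]
    rwa [← mul_assoc, zpow_neg, mul_inv_cancel₀ hqa, one_mul, mul_one] at this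

/-- **Characteristic `2`, multiplicity exactly `2` at EVERY cusp** (the transport the docstring of
`tendsto_thetaDdot_div_sub_one_sq_of_two_eq_zero` announces): for `0 < ‖q̈‖ < 1` and `a ∈ ℤ`,
`Θ̈(W)/(W − q̈^a)² → q̈^{−a(a+2)} ∏_{n ≥ 1} (1 − q̈^{2n})³` as `W → q̈^a`, `W ≠ q̈^a` — pull the case
`a = 0` back along `W ↦ q̈^{−a} W` using `Θ̈(q̈^a Ü) = q̈^{−a²} Ü^{−2a} Θ̈(Ü)` (the sign `(−1)^a` is `1`
in characteristic `2`) and `(q̈^{−a} W − 1)² = q̈^{−2a} (W − q̈^a)²`. The limit is non-zero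
(`tprod_one_sub_qpow_succ_pow_three_ne_zero`); the cusp `−q̈^a` is the same point.
[cite: MochizukiEtTh2009, Prop 1.4 (i) p.21] -/
theorem tendsto_thetaDdot_div_sub_zpow_sq_of_two_eq_zero (hq0 : q2 ≠ 0) (hq : ‖q2‖ < 1)
    (h2 : (2 : L) = 0) (a : ℤ) :
    Tendsto (fun W : L => thetaDdot q2 W / (W - q2 ^ a) ^ 2) (𝓝[≠] (q2 ^ a))
      (𝓝 (q2 ^ (-(a * (a + 2))) * (∏' n : ℕ, (1 - q2 ^ (2 * (n + 1)))) ^ 3)) := by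
  have hqa : q2 ^ a ≠ 0 := zpow_ne_zero a hq0
  have hm1 : ((a.negOnePow : ℤ) : L) = 1 := by
    have h11 : (1 : L) + 1 = 0 := by rw [← two_mul, mul_one, h2]
    rw [Int.cast_negOnePow, show (-1 : L) = 1 from neg_eq_of_add_eq_zero_left h11, one_zpow]
  -- the limit at `1` of `Ü ↦ Ü^{−2a} · Θ̈(Ü)/(Ü − 1)²`, pulled back along `W ↦ q̈^{−a} W`
  have hz : Tendsto (fun U : L => U ^ (-(2 * a))) (𝓝[≠] 1) (𝓝 1) := by
    have h := (continuousAt_zpow₀ (1 : L) (-(2 * a)) (Or.inl one_ne_zero)).tendsto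
    rw [one_zpow] at h
    exact h.mono_left nhdsWithin_le_nhds
  have hlim := ((hz.mul (tendsto_thetaDdot_div_sub_one_sq_of_two_eq_zero hq h2)).const_mul
    (q2 ^ (-(a * (a + 2))))).comp (tendsto_zpow_neg_mul_nhdsWithin hq0 a)
  rw [one_mul] at hlim
  refine hlim.congr' ?_
  filter_upwards [self_mem_nhdsWithin, mem_nhdsWithin_of_mem_nhds (eventually_ne_nhds hqa)]
    with W hWa hW0
  have hU : q2 ^ (-a) * W ≠ 0 := mul_ne_zero (zpow_ne_zero _ hq0) hW0
  -- `Θ̈(W) = q̈^{−a²} (q̈^{−a} W)^{−2a} Θ̈(q̈^{−a} W)`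
  have hfe := thetaDdot_zpow_mul hq0 hU a
  rw [← mul_assoc, ← zpow_add₀ hq0, add_neg_cancel, zpow_zero, one_mul, hm1, one_mul] at hfe
  -- `(q̈^{−a} W − 1)² = q̈^{−2a} (W − q̈^a)²`
  have hsq : (q2 ^ (-a) * W - 1) ^ 2 = q2 ^ (-(2 * a)) * (W - q2 ^ a) ^ 2 := by
    have e : q2 ^ (-a) * W - 1 = q2 ^ (-a) * (W - q2 ^ a) := by
      rw [mul_sub, zpow_neg, inv_mul_cancel₀ hqa]
    rw [e, mul_pow, ← zpow_natCast (q2 ^ (-a)) 2, ← zpow_mul]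
    congr 2
    push_cast
    ring
  have hWa' : (W - q2 ^ a) ^ 2 ≠ 0 := pow_ne_zero 2 (sub_ne_zero.mpr hWa)
  have hq2a : q2 ^ (-(2 * a)) ≠ 0 := zpow_ne_zero _ hq0
  have e4 : q2 ^ (-(a * (a + 2))) = q2 ^ (-(a * a)) * q2 ^ (-(2 * a)) := by
    rw [← zpow_add₀ hq0]
    congr 1
    ring
  simp only [Function.comp_apply]
  rw [hfe, hsq, e4]
  field_simp

/-- Packaging for the cusps of Prop. 1.4 (i) in characteristic `2` (`0 < ‖q̈‖ < 1`): at every cusp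
`±q̈^a` the quotient `Θ̈(W)/(W ∓ q̈^a)²` has ONE AND THE SAME NON-ZERO limit — each zero of `Θ̈` has
multiplicity exactly `2` (never `1`: `ClassicalThetaSimpleZerosFacts.not_thetaDdotSimpleZeros`; never
more). [cite: MochizukiEtTh2009, Prop 1.4 (i) p.21] -/
theorem exists_tendsto_thetaDdot_div_sq_of_two_eq_zero (hq0 : q2 ≠ 0) (hq : ‖q2‖ < 1)
    (h2 : (2 : L) = 0) (a : ℤ) :
    ∃ c : L, c ≠ 0 ∧
      Tendsto (fun W : L => thetaDdot q2 W / (W - q2 ^ a) ^ 2) (𝓝[≠] (q2 ^ a)) (𝓝 c) ∧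
      Tendsto (fun W : L => thetaDdot q2 W / (W - -(q2 ^ a)) ^ 2) (𝓝[≠] (-(q2 ^ a))) (𝓝 c) := by
  refine ⟨_, mul_ne_zero (zpow_ne_zero _ hq0) (tprod_one_sub_qpow_succ_pow_three_ne_zero hq),
    tendsto_thetaDdot_div_sub_zpow_sq_of_two_eq_zero hq0 hq h2 a, ?_⟩
  rw [neg_zpow_eq_zpow_of_two_eq_zero h2]
  exact tendsto_thetaDdot_div_sub_zpow_sq_of_two_eq_zero hq0 hq h2 a

end CharTwoCusps

end Literature.AnabelianGeometry.EtaleTheta
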